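import Summits.BirchSwinnertonDyer.BirchSwinnertonDyer.Theses.KimAtThreeKolyvagin
import HarnessLib

/-! BC3 birth skeleton for crux `KimAtThreeKolyvagin.DeepLowerAtThree` (route KimAtThreeKolyvagin, rung W2):
v2 (A12-admitted shape, planner g12): named stubs (the ONLY sorried declarations) + the kernel-checked composition `DeepLowerAtThree_of` concluding the crux BY NAME. -/

noncomputable section

open scoped MatrixGroups ModularForm Classical

open CongruenceSubgroup WeierstrassCurve Literature.NumberTheory.EllipticCurves
  Literature.NumberTheory.EllipticCurves.ModularForms
  Literature.NumberTheory.EllipticCurves.Kim2025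
  Literature.NumberTheory.EllipticCurves.Rank1Residual
  Literature.NumberTheory.EllipticCurves.Rank1Residual.Typed

set_option linter.dupNamespace false

namespace Summit.BirchSwinnertonDyer.BirchSwinnertonDyer.Cruxes.DeepLowerAtThree.Birth

open Summit.BirchSwinnertonDyer.Rank1Residual.Additive
open Summit.BirchSwinnertonDyer.Rank1Residual.X4
open Summit.BirchSwinnertonDyer.BirchSwinnertonDyer.Theses.KimAtThreeKolyvagin


/-! BC3 birth skeleton for crux `DeepLowerAtThree` (coefficient-depth split: the `m = 1` slice vs the `3^k`-tower). -/

/-- stub (shaTrivialSlice = BC5 plan-only rung): the lower inequality when `Ш(E)[3^∞] = 0` — the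
`m = 1` (coefficients `ℤ/3`) slice of the Kolyvagin-system package, where the tree has PROVED machinery at
`p = 3` (`GaloisImage.kolyvaginSystems_freeRankOne_zmod_three_pow_at_one`, `KolyvaginStubVanishing` = MR04 Thm
4.3.4 at `m = 1`): `Sel(ℚ,E[3]) = 0` forces the primitive system to have `κ₁ ≢ 0 (mod 3)`, whence
`∂^{(0)}(δ̃) = ∂^{(∞)}_{deep}(δ̃)` through the dictionary Prop D. -/
theorem stub_lower_shaTrivial :
  ∀ (W : WeierstrassCurve ℚ) [W.IsElliptic] [W.IsGloballyMinimal],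
    (∀ n : ℕ, W.HasSurjectiveModNGaloisRep (3 ^ n : ℕ)) →
    Finite W.sha →
    ∀ {N : ℕ} [NeZero N] (f : CuspForm (Gamma0 N) 2), IsNewformOf W f →
    (∀ r : ℚ, ratPlusSymbol f r ≠ 0 → 0 ≤ padicValRat 3 (ratPlusSymbol f r)) →
    kuriharaVanishingOrder W 3 f = 0 →
    Nat.card (AddCommGroup.primaryComponent W.sha 3) = 1 →
      ∃ d : ℕ, kuriharaPartialDeepInfty W 3 f = d ∧
        kuriharaPartial W 3 f 0 ≤
          ((padicValNat 3 (Nat.card (AddCommGroup.primaryComponent W.sha 3)) + d : ℕ) : ℕ∞) := by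
  sorry

/-- stub (shaNontrivialSlice): the lower inequality when `Ш(E)[3^∞] ≠ 0` — needs the full `3^k`-tower of
Kolyvagin systems (Sakamoto 2024 Thm 4.4 at every `m`, core-vertex compatibility, MR04 §5.2 limit
`KS̄(T₃E) = ℤ₃·κ⁰`) and the rigidity EQUALITY `length Sel₀ = ∂^{(0)}(κ⁰)` (MR04 Thm 5.2.12 (ii)/Cor 5.2.13 with
Sakamoto's connectedness of `𝒳⁰`, JTNB 2024 Thm 6.7, replacing (H.4)). -/
theorem stub_lower_shaNontrivial :
  ∀ (W : WeierstrassCurve ℚ) [W.IsElliptic] [W.IsGloballyMinimal],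
    (∀ n : ℕ, W.HasSurjectiveModNGaloisRep (3 ^ n : ℕ)) →
    Finite W.sha →
    ∀ {N : ℕ} [NeZero N] (f : CuspForm (Gamma0 N) 2), IsNewformOf W f →
    (∀ r : ℚ, ratPlusSymbol f r ≠ 0 → 0 ≤ padicValRat 3 (ratPlusSymbol f r)) →
    kuriharaVanishingOrder W 3 f = 0 →
    Nat.card (AddCommGroup.primaryComponent W.sha 3) ≠ 1 →
      ∃ d : ℕ, kuriharaPartialDeepInfty W 3 f = d ∧
        kuriharaPartial W 3 f 0 ≤
          ((padicValNat 3 (Nat.card (AddCommGroup.primaryComponent W.sha 3)) + d : ℕ) : ℕ∞) := by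
  sorry

/-- BC3 composition = THE SKELETON (A12 shape, v2): the crux BY NAME with NO hypotheses, from exactly the two
registered stubs (`Ш[3^∞]` trivial / non-trivial, `eq_or_ne`); kernel-checked, no sorry of its own. -/
theorem DeepLowerAtThree_of :
    Summit.BirchSwinnertonDyer.BirchSwinnertonDyer.Theses.KimAtThreeKolyvagin.DeepLowerAtThree := by
  intro W _ _ htower hfin N _ f hf hint hord
  rcases eq_or_ne (Nat.card (AddCommGroup.primaryComponent W.sha 3)) 1 with hs | hs
  · exact stub_lower_shaTrivial W htower hfin f hf hint hord hs
  · exact stub_lower_shaNontrivial W htower hfin f hf hint hord hs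

end Summit.BirchSwinnertonDyer.BirchSwinnertonDyer.Cruxes.DeepLowerAtThree.Birth

end
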